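import Summits.AnomalousDissipation.AnomalousDissipation.Theses.StirringSphere
import Summits.AnomalousDissipation.AnomalousDissipation.Theses.Ensemble
import Summits.AnomalousDissipation.AnomalousDissipation.Theorems.ResolvedDissipation.Negative.LoadBearing
import Summits.AnomalousDissipation.AnomalousDissipation.Theorems.MirrorVarietySteadyWeakIsGlobalLerayHopf
import Literature.Analysis.FluidPDE.DoeringFoiasProofs
import Literature.Analysis.FluidPDE.DoeringFoiasPowerProofs
import Literature.Analysis.FluidPDE.StatisticalSolutionDirac
import Literature.Analysis.FluidPDE.StatisticalSolutionProofs
import Literature.Analysis.FunctionSpaces.TorusSobolevSpaceProofs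

/-!
# Negative knowledge for the crux `EnsembleRealization` (stmt-AnomalousDissipation-0215; routes
# StirringSphere rank 5 / Ensemble rank 3 — the two route decls are the same term, `Iff.rfl`)

Refuter crux-attack (refuter-rattack-stmt-AnomalousDissipation-0215-0, 2026-08-17). Supports the item; no
positive route-item statement is asserted. The refuted weakening / strengthening are stated INLINE.

THE CRUX: `∀ f` smooth solenoidal mean-zero, `∀ E ε`, `0 < ε → ∃ M, ∀ ν μ, 0 < ν →` Foias–Prodi-stationary
`μ` at `(ν, f)` `→ Integrable ‖u‖² μ → ∫|u|² dμ ≤ E → ε ≤ ν∫‖∇u‖² dμ → ∃ u₀ u,` global Leray–Hopf at `(ν, f)`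
with `meanEnergy u ≤ M ∧ ε/2 ≤ meanDissipation ν u`.

One witness family serves throughout: the Dirac law at the laminar shear state `K_{M,a} = a cos(2πMx₁)e₀`
(`ResolvedDissipation/Negative/ShearMode`), which is a FOIAS–PRODI stationary statistical solution of
NS_ν forced by `4π²νM² K_{M,a}` (`isStationaryStatisticalSolution_dirac_shearState`: steady weak solution in
`V` with the energy EQUATION, via `IsSteadyWeakSolution.isStationaryStatisticalSolution_dirac`), with energy
`a²/2`, dissipation `2π²νM²a²`, and realised by its own constant Leray–Hopf path (`laminar_realised`, from the
landed `steadyWeakIsGlobalLerayHopf_proof`).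

* `ensembleRealization_iff_without_nu_pos` — DECORATION: `0 < ν` is implied by the floor `0 < ε ≤ ν·toReal _`.
* `integrable_norm_sq_of_isStationaryStatisticalSolution`, `ensembleRealization_iff_without_integrable` —
  DECORATION: `Integrable ‖u‖² μ` follows from (1.29) and the Poincaré inequality on `H`.
* `realised_of_dirac_steady` — SMALL MODELS: on Dirac laws at steady states (in `V`, energy equation) the
  conclusion holds with `M = E` and WITHOUT the loss `1/2`; atoms cannot refute the crux.
* `ensembleRealization_false_without_loud` — LOAD-BEARING: delete `ε ≤ ensembleDissipation ν μ` and the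
  statement is FALSE (`f = 0`, `δ₀`, Doering–Foias budget `meanDissipation ≤ ‖f‖₂ √meanEnergy = 0`).
* `laminar_energy_floor`, `not_ensembleRealization_uniformM` — REFUTED STRENGTHENING: `∃ M ∀ E ε` is FALSE;
  any admissible `M(f, E, ε)` at the laminar budgets of `K_{1,1}` obeys `ε/2 ≤ ‖f‖₂ √(max M 0)`.
* `budget_of_admissible`, `ensembleRealization_vacuous_regime` — VACUITY REGIME: admissible budgets satisfy
  `ε ≤ ‖f‖₂ √E`; beyond it the crux holds for every `M` (no FP measure meets the hypotheses).
-/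

noncomputable section

-- `Summit.<Summit>.<Problem>` is the tree's mandated summit-side namespace (CONVENTIONS §2); for this
-- single-conjunct summit the two segments coincide, so the duplicate is deliberate.
set_option linter.dupNamespace false

namespace Summit.AnomalousDissipation.AnomalousDissipation.Theorems.EnsembleRealization.Negative

open MeasureTheory Filter Topology
open scoped ENNReal InnerProductSpace RealInnerProductSpace
open Literature.Analysis.FunctionSpaces Literature.Analysis.FluidPDE
open Summit.AnomalousDissipation.AnomalousDissipation.Theses.StirringSphere (EnsembleRealization)
open Summit.AnomalousDissipation.AnomalousDissipation.Theorems.ResolvedDissipation.Negative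

/-! ## §0 The two route copies coincide -/

/-- The StirringSphere and Ensemble copies of the crux are the same proposition. [folklore] -/
theorem ensembleRealization_iff_ensemble :
    EnsembleRealization ↔ Summit.AnomalousDissipation.AnomalousDissipation.Theses.Ensemble.EnsembleRealization :=
  Iff.rfl

/-! ## §1 The laminar witness family: Dirac laws at shear states are Foias–Prodi stationary -/

/-- `((K_{M,a}), K_{M,c a}) = c a²/2`. [folklore] -/
theorem pairing_shearState_shearField {M : ℕ} (hM : M ≠ 0) (c a : ℝ) :
    Torus.pairing (shearState M hM a).1 (shearField M (c * a)) = c * (a ^ 2 / 2) := by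
  unfold Torus.pairing
  have h : (fun x => ⟪((shearState M hM a).1 : T3 → R3) x, shearField M (c * a) x⟫_ℝ) =ᵐ[volume]
      fun x => c * ‖shearField M a x‖ ^ 2 := by
    filter_upwards [coe_shearState_ae hM a] with x hx
    rw [hx, shearField_mul, real_inner_smul_right, real_inner_self_eq_norm_sq]
  rw [integral_congr_ae h, integral_const_mul, integral_norm_sq_shearField hM a]

/-- The energy EQUATION of the laminar state: `ν‖∇K_{M,a}‖² = (K_{M,a}, 4π²νM²K_{M,a}) = 2π²νM²a²`. [folklore] -/
theorem laminar_energy_eq {M : ℕ} (hM : M ≠ 0) (ν a : ℝ) :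
    ν * (Torus.eGradNormSq ((shearState M hM a).1 : T3 → R3)).toReal =
      Torus.pairing (shearState M hM a).1 (shearField M (4 * Real.pi ^ 2 * ν * (M : ℝ) ^ 2 * a)) := by
  rw [eGradNormSq_shearState hM a, ENNReal.toReal_ofReal (by positivity), pairing_shearState_shearField hM]
  ring

/-- `K_{M,a}` is a steady weak solution of NS_ν at force `4π²νM²K_{M,a}`. [folklore] -/
theorem isSteadyWeakSolution_shearState {M : ℕ} (hM : M ≠ 0) (ν a : ℝ) :
    Torus.IsSteadyWeakSolution ν (shearField M (4 * Real.pi ^ 2 * ν * (M : ℝ) ^ 2 * a)) (shearState M hM a) :=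
  fun _w hw _ _ => nsGeneratorPairing_shearField (coe_shearState_ae hM a) hw

/-- `K_{M,a} ∈ V`. [folklore] -/
theorem shearState_mem_energySpaceV {M : ℕ} (hM : M ≠ 0) (a : ℝ) :
    (shearState M hM a).1 ∈ Torus.energySpaceV (Fin 3) :=
  Torus.smoothSolenoidal_subset_energySpaceV_holds
    ⟨shearField M a, isSmooth_shearField M a, isDivFree_shearField M a, hasZeroMean_shearField hM a,
      coe_shearState_ae hM a⟩

/-- **The laminar Dirac is Foias–Prodi stationary**: `δ_{K_{M,a}}` is a stationary statistical solution
(FMRT IV Def. 1.3: (1.29)–(1.31)) of NS_ν forced by `4π²νM² K_{M,a}`, for EVERY `ν`. [folklore] -/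
theorem isStationaryStatisticalSolution_dirac_shearState {M : ℕ} (hM : M ≠ 0) (ν a : ℝ) :
    Torus.IsStationaryStatisticalSolution ν (shearField M (4 * Real.pi ^ 2 * ν * (M : ℝ) ^ 2 * a))
      (Measure.dirac (shearState M hM a)) :=
  (isSteadyWeakSolution_shearState hM ν a).isStationaryStatisticalSolution_dirac
    (shearState_mem_energySpaceV hM a) (laminar_energy_eq hM ν a).le

/-- Energy of a Dirac law: `∫|u|² dδ_U = ‖U‖²`. [folklore] -/
theorem ensembleEnergy_dirac (U : H3) : Torus.ensembleEnergy (Measure.dirac U) = ‖U‖ ^ 2 := by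
  haveI : MeasurableSingletonClass H3 := OpensMeasurableSpace.toMeasurableSingletonClass
  unfold Torus.ensembleEnergy
  rw [integral_dirac]

/-- Dissipation of a Dirac law: `ν∫‖∇u‖² dδ_U = ν‖∇U‖²`. [folklore] -/
theorem ensembleDissipation_dirac (ν : ℝ) (U : H3) :
    Torus.ensembleDissipation ν (Measure.dirac U) = ν * (Torus.eGradNormSq (U.1 : T3 → R3)).toReal := by
  haveI : MeasurableSingletonClass H3 := OpensMeasurableSpace.toMeasurableSingletonClass
  unfold Torus.ensembleDissipation Torus.ensembleEnstrophy
  rw [lintegral_dirac]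

/-- **The laminar state realises itself**: the constant path at `K_{M,a}` is a global Leray–Hopf solution of
NS_ν forced by `4π²νM²K_{M,a}` with `meanEnergy = a²/2` and `meanDissipation = 2π²νM²a²` (landed
`steadyWeakIsGlobalLerayHopf_proof`). [folklore] -/
theorem laminar_realised {M : ℕ} (hM : M ≠ 0) {ν : ℝ} (hν : 0 < ν) (a : ℝ) :
    Torus.IsGlobalLerayHopf ν (fun _ => shearField M (4 * Real.pi ^ 2 * ν * (M : ℝ) ^ 2 * a))
        ((shearState M hM a).1 : T3 → R3) (fun _ => ((shearState M hM a).1 : T3 → R3)) ∧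
      meanEnergy (fun _ : ℝ => ((shearState M hM a).1 : T3 → R3)) = a ^ 2 / 2 ∧
      meanDissipation ν (fun _ : ℝ => ((shearState M hM a).1 : T3 → R3)) =
        ν * (2 * Real.pi ^ 2 * (M : ℝ) ^ 2 * a ^ 2) := by
  obtain ⟨h1, h2, h3⟩ := steadyWeakIsGlobalLerayHopf_proof ν _ (shearState M hM a) hν (isSmooth_shearField M _)
    (hasZeroMean_shearField hM _) (shearState_mem_energySpaceV hM a) (isSteadyWeakSolution_shearState hM ν a)
    (laminar_energy_eq hM ν a)
  refine ⟨h1, ?_, ?_⟩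
  · rw [h2, Torus.integral_norm_sq_coe_eq]
    exact norm_sq_shearState hM a
  · rw [h3, eGradNormSq_shearState hM a, ENNReal.toReal_ofReal (by positivity)]

/-! ## §2 Small models: Dirac laws at steady states are realised with `M = E` and no loss -/

/-- **On atoms the crux holds with room.** If `U ∈ V` is a steady weak solution with the energy equation, then
for every budget pair met by `δ_U` the constant path realises it with `meanEnergy ≤ E` and `meanDissipation ≥ ε`
(not only `ε/2`). [folklore] -/
theorem realised_of_dirac_steady {ν : ℝ} (hν : 0 < ν) {f : T3 → R3} (hf : Torus.IsSmooth f)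
    (hf0 : Torus.HasZeroMean f) {U : H3} (hV : U.1 ∈ Torus.energySpaceV (Fin 3))
    (hU : Torus.IsSteadyWeakSolution ν f U)
    (heq : ν * (Torus.eGradNormSq (U.1 : T3 → R3)).toReal = Torus.pairing U.1 f)
    {E ε : ℝ} (hE : Torus.ensembleEnergy (Measure.dirac U) ≤ E)
    (hε : ε ≤ Torus.ensembleDissipation ν (Measure.dirac U)) :
    ∃ (u₀ : T3 → R3) (u : ℝ → T3 → R3), Torus.IsGlobalLerayHopf ν (fun _ => f) u₀ u ∧
      meanEnergy u ≤ E ∧ ε ≤ meanDissipation ν u := by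
  obtain ⟨h1, h2, h3⟩ := steadyWeakIsGlobalLerayHopf_proof ν f U hν hf hf0 hV hU heq
  refine ⟨_, _, h1, ?_, ?_⟩
  · rw [h2, Torus.integral_norm_sq_coe_eq]
    have hE' : ‖U‖ ^ 2 ≤ E := by rwa [ensembleEnergy_dirac] at hE
    exact hE'
  · rw [h3, ← ensembleDissipation_dirac]
    exact hε

/-! ## §3 Decorations: `0 < ν` and `Integrable ‖u‖² μ` are implied by the other hypotheses -/

/-- **DECORATION 1.** The clause `0 < ν` is implied by the floor: `ensembleDissipation ν μ = ν · toReal _ ≤ 0`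
for `ν ≤ 0`. The crux with `0 < ν` DELETED is equivalent to the crux. [folklore] -/
theorem ensembleRealization_iff_without_nu_pos :
    EnsembleRealization ↔
      ∀ f : UnitAddTorus (Fin 3) → EuclideanSpace ℝ (Fin 3), Literature.Analysis.FunctionSpaces.Torus.IsSmooth f → Literature.Analysis.FunctionSpaces.Torus.IsDivFree f → Literature.Analysis.FunctionSpaces.Torus.HasZeroMean f → ∀ (E ε : ℝ), 0 < ε → ∃ M : ℝ, ∀ (ν : ℝ) (μ : MeasureTheory.Measure (Literature.Analysis.FunctionSpaces.Torus.energySpace (Fin 3))), Literature.Analysis.FluidPDE.Torus.IsStationaryStatisticalSolution ν f μ → MeasureTheory.Integrable (fun u => ‖u‖ ^ 2) μ → Literature.Analysis.FluidPDE.Torus.ensembleEnergy μ ≤ E → ε ≤ Literature.Analysis.FluidPDE.Torus.ensembleDissipation ν μ → ∃ (u₀ : UnitAddTorus (Fin 3) → EuclideanSpace ℝ (Fin 3)) (u : ℝ → UnitAddTorus (Fin 3) → EuclideanSpace ℝ (Fin 3)), Literature.Analysis.FluidPDE.Torus.IsGlobalLerayHopf ν (fun _ => f) u₀ u ∧ Literature.Analysis.FluidPDE.meanEnergy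 u ≤ M ∧ ε / 2 ≤ Literature.Analysis.FluidPDE.meanDissipation ν u := by
  refine ⟨fun h f hf hd hz E ε hε => ?_, fun h f hf hd hz E ε hε => ?_⟩
  · obtain ⟨M, hM⟩ := h f hf hd hz E ε hε
    refine ⟨M, fun ν μ hμ hi hE hεμ => hM ν μ ?_ hμ hi hE hεμ⟩
    by_contra hν
    have : Torus.ensembleDissipation ν μ ≤ 0 :=
      mul_nonpos_of_nonpos_of_nonneg (not_lt.1 hν) ENNReal.toReal_nonneg
    linarith
  · obtain ⟨M, hM⟩ := h f hf hd hz E ε hε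
    exact ⟨M, fun ν μ _ hμ hi hE hεμ => hM ν μ hμ hi hE hεμ⟩

/-- **Finite mean enstrophy gives finite mean energy**: a Foias–Prodi stationary statistical solution has
`∫ |u|² dμ < ∞` ((1.29) and the Poincaré inequality `|u|² ≤ ‖∇u‖²` on `H`, `Torus.enorm_sq_le_eGradNormSq`). [folklore] -/
theorem integrable_norm_sq_of_isStationaryStatisticalSolution {ν : ℝ} {f : T3 → R3} {μ : Measure H3}
    (hμ : Torus.IsStationaryStatisticalSolution ν f μ) : Integrable (fun u : H3 => ‖u‖ ^ 2) μ := by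
  refine ⟨(continuous_norm.pow 2).aestronglyMeasurable, ?_⟩
  have hle : ∀ u : H3, ‖‖u‖ ^ 2‖ₑ ≤ Torus.eGradNormSq (u.1 : T3 → R3) := fun u => by
    rw [Real.enorm_eq_ofReal (sq_nonneg _), ENNReal.ofReal_pow (norm_nonneg _), ofReal_norm]
    exact Torus.enorm_sq_le_eGradNormSq u
  exact lt_of_le_of_lt (lintegral_mono hle) hμ.enstrophy_finite

/-- **DECORATION 2.** The clause `Integrable (fun u => ‖u‖ ^ 2) μ` is implied by Foias–Prodi stationarity;
the crux with it DELETED is equivalent to the crux. [folklore] -/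
theorem ensembleRealization_iff_without_integrable :
    EnsembleRealization ↔
      ∀ f : UnitAddTorus (Fin 3) → EuclideanSpace ℝ (Fin 3), Literature.Analysis.FunctionSpaces.Torus.IsSmooth f → Literature.Analysis.FunctionSpaces.Torus.IsDivFree f → Literature.Analysis.FunctionSpaces.Torus.HasZeroMean f → ∀ (E ε : ℝ), 0 < ε → ∃ M : ℝ, ∀ (ν : ℝ) (μ : MeasureTheory.Measure (Literature.Analysis.FunctionSpaces.Torus.energySpace (Fin 3))), 0 < ν → Literature.Analysis.FluidPDE.Torus.IsStationaryStatisticalSolution ν f μ → Literature.Analysis.FluidPDE.Torus.ensembleEnergy μ ≤ E → ε ≤ Literature.Analysis.FluidPDE.Torus.ensembleDissipation ν μ → ∃ (u₀ : UnitAddTorus (Fin 3) → EuclideanSpace ℝ (Fin 3)) (u : ℝ → UnitAddTorus (Fin 3) → EuclideanSpace ℝ (Fin 3)), Literature.Analysis.FluidPDE.Torus.IsGlobalLerayHopf ν (fun _ => f) u₀ u ∧ Literature.Analysis.FluidPDE.meanEnergy u ≤ M ∧ ε / 2 ≤ Literature.Analysis.FluidPDE.meanDissipation ν u := by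
  refine ⟨fun h f hf hd hz E ε hε => ?_, fun h f hf hd hz E ε hε => ?_⟩
  · obtain ⟨M, hM⟩ := h f hf hd hz E ε hε
    exact ⟨M, fun ν μ hν hμ hE hεμ => hM ν μ hν hμ (integrable_norm_sq_of_isStationaryStatisticalSolution hμ) hE hεμ⟩
  · obtain ⟨M, hM⟩ := h f hf hd hz E ε hε
    exact ⟨M, fun ν μ hν hμ _ hE hεμ => hM ν μ hν hμ hE hεμ⟩

/-! ## §4 Load-bearing: the dissipation floor -/

/-- **The Doering–Foias budget of a global Leray–Hopf solution** (`ν > 0`, smooth mean-zero steady force):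
`meanDissipation ν u ≤ ‖f‖₂ √(meanEnergy u)` (in tree: `DoeringFoias2002_dissipation_le_power_holds` and
`IsGlobalLerayHopf.meanPower_le`). [cite: CheskidovDoeringPetrov2006, eq. (11) and eq. (17)] -/
theorem lerayHopf_budget {ν : ℝ} (hν : 0 < ν) {f : T3 → R3} (hf : Torus.IsSmooth f)
    (hf0 : Torus.HasZeroMean f) {u₀ : T3 → R3} {u : ℝ → T3 → R3}
    (hu : Torus.IsGlobalLerayHopf ν (fun _ => f) u₀ u) :
    meanDissipation ν u ≤ Real.sqrt (∫ x, ‖f x‖ ^ 2) * Real.sqrt (meanEnergy u) := by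
  have h1 := DoeringFoias2002_dissipation_le_power_holds hν (hf.memLp 2) hf0 u₀ u hu
  have h2 := hu.meanPower_le hν hf hf0
  rw [rmsVelocity_eq_sqrt_meanEnergy] at h2
  exact h1.trans h2

/-- `δ₀` (the Dirac law at rest, `K_{1,0} = 0`) is Foias–Prodi stationary for the UNFORCED equations at every
viscosity. [folklore] -/
theorem isStationaryStatisticalSolution_dirac_rest (ν : ℝ) :
    Torus.IsStationaryStatisticalSolution ν (0 : T3 → R3) (Measure.dirac (shearState 1 one_ne_zero 0)) := by
  have h := isStationaryStatisticalSolution_dirac_shearState one_ne_zero ν 0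
  rwa [mul_zero, shearField_zero] at h

/-- **The dissipation floor is load-bearing.** With the clause `ε ≤ ensembleDissipation ν μ` DELETED the
statement is FALSE: at `f = 0` the law `δ₀` meets every remaining hypothesis (`ν = 1`, `E = 0`), while no
global Leray–Hopf solution of unforced NS dissipates `ε/2 = 1/2` in the mean (`meanDissipation ≤ ‖0‖₂√· = 0`).
So any proof must USE the floor quantitatively (it is the only hypothesis distinguishing `μ` from `δ₀`).
(The refuted statement — WEAKENING 1 — `EnsembleRealization` without `ε ≤ ensembleDissipation ν μ`, all else
verbatim.) [folklore] -/
theorem ensembleRealization_false_without_loud :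
    ¬ (∀ f : UnitAddTorus (Fin 3) → EuclideanSpace ℝ (Fin 3), Literature.Analysis.FunctionSpaces.Torus.IsSmooth f → Literature.Analysis.FunctionSpaces.Torus.IsDivFree f → Literature.Analysis.FunctionSpaces.Torus.HasZeroMean f → ∀ (E ε : ℝ), 0 < ε → ∃ M : ℝ, ∀ (ν : ℝ) (μ : MeasureTheory.Measure (Literature.Analysis.FunctionSpaces.Torus.energySpace (Fin 3))), 0 < ν → Literature.Analysis.FluidPDE.Torus.IsStationaryStatisticalSolution ν f μ → MeasureTheory.Integrable (fun u => ‖u‖ ^ 2) μ → Literature.Analysis.FluidPDE.Torus.ensembleEnergy μ ≤ E → ∃ (u₀ : UnitAddTorus (Fin 3) → EuclideanSpace ℝ (Fin 3)) (u : ℝ → UnitAddTorus (Fin 3) → EuclideanSpace ℝ (Fin 3)), Literature.Analysis.FluidPDE.Torus.IsGlobalLerayHopf ν (fun _ => f) u₀ u ∧ Literature.Analysis.FluidPDE.meanEnergy u ≤ M ∧ ε / 2 ≤ Literature.Analysis.FluidPDE.meanDissipation ν u) := by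
  intro h
  obtain ⟨M, hM⟩ := h 0 isSmooth_zero isDivFree_zero hasZeroMean_zero 0 1 one_pos
  obtain ⟨u₀, u, hu, -, hε⟩ := hM 1 _ one_pos (isStationaryStatisticalSolution_dirac_rest 1)
    (Torus.integrable_dirac _ _) (le_of_eq (by rw [ensembleEnergy_dirac, norm_sq_shearState]; ring))
  have hb := lerayHopf_budget one_pos isSmooth_zero hasZeroMean_zero hu
  simp at hb
  linarith

/-! ## §5 Refuted strengthening: `M` cannot precede the budgets; the realised-energy floor -/

/-- **THE REALISED-ENERGY FLOOR (tightness reading).** For the fixed force `K_{1,1}` and every `ν > 0` the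
laminar law `δ_{K_{1,a}}`, `a = 1/(4π²ν)`, is admissible with `E = a²/2`, `ε = 2π²νa²`; hence ANY `M` for which
the crux's implication holds at these budgets satisfies `ε/2 = 1/(16π²ν) ≤ √(1/2)·√(max M 0)`, i.e.
`M ≥ ε²/(2‖f‖₂²)`: the realised energy ceiling cannot sit below the injection scale. [folklore] -/
theorem laminar_energy_floor {ν : ℝ} (hν : 0 < ν) {M : ℝ}
    (h : ∀ μ : Measure H3,
      Torus.IsStationaryStatisticalSolution ν (shearField 1 1) μ → Integrable (fun u : H3 => ‖u‖ ^ 2) μ →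
        Torus.ensembleEnergy μ ≤ (1 / (4 * Real.pi ^ 2 * ν)) ^ 2 / 2 →
          ν * (2 * Real.pi ^ 2 * ((1 : ℕ) : ℝ) ^ 2 * (1 / (4 * Real.pi ^ 2 * ν)) ^ 2) ≤ Torus.ensembleDissipation ν μ →
            ∃ (u₀ : T3 → R3) (u : ℝ → T3 → R3), Torus.IsGlobalLerayHopf ν (fun _ => shearField 1 1) u₀ u ∧
              meanEnergy u ≤ M ∧ ν * (2 * Real.pi ^ 2 * ((1 : ℕ) : ℝ) ^ 2 * (1 / (4 * Real.pi ^ 2 * ν)) ^ 2) / 2 ≤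
                meanDissipation ν u) :
    1 / (16 * Real.pi ^ 2 * ν) ≤ Real.sqrt (1 / 2) * Real.sqrt (max M 0) := by
  have hπ : 0 < Real.pi := Real.pi_pos
  have hν0 : ν ≠ 0 := hν.ne'
  set a : ℝ := 1 / (4 * Real.pi ^ 2 * ν) with ha
  have hfa : shearField 1 (4 * Real.pi ^ 2 * ν * ((1 : ℕ) : ℝ) ^ 2 * a) = shearField 1 1 := by
    congr 1
    simp only [ha, Nat.cast_one, one_pow, mul_one]
    field_simp
  have hFP := isStationaryStatisticalSolution_dirac_shearState one_ne_zero ν a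
  rw [hfa] at hFP
  obtain ⟨u₀, u, hu, hMe, hε⟩ := h _ hFP (Torus.integrable_dirac _ _)
    (le_of_eq (by rw [ensembleEnergy_dirac, norm_sq_shearState]))
    (ge_of_eq (by rw [ensembleDissipation_dirac, eGradNormSq_shearState, ENNReal.toReal_ofReal (by positivity)]))
  have hb := lerayHopf_budget hν (isSmooth_shearField 1 1) (hasZeroMean_shearField one_ne_zero 1) hu
  rw [integral_norm_sq_shearField one_ne_zero, one_pow] at hb
  have hme : Real.sqrt (meanEnergy u) ≤ Real.sqrt (max M 0) := Real.sqrt_le_sqrt (hMe.trans (le_max_left _ _))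
  have hdiss : meanDissipation ν u ≤ Real.sqrt (1 / 2) * Real.sqrt (max M 0) :=
    hb.trans (mul_le_mul_of_nonneg_left hme (Real.sqrt_nonneg _))
  have hval : ν * (2 * Real.pi ^ 2 * ((1 : ℕ) : ℝ) ^ 2 * a ^ 2) / 2 = 1 / (16 * Real.pi ^ 2 * ν) := by
    simp only [ha, Nat.cast_one, one_pow, mul_one]
    field_simp
    ring
  linarith

/-- **`M` CANNOT BE CHOSEN BEFORE THE BUDGETS** (`∃ M ∀ E ε` is FALSE; `M = M(f, E, ε)` genuinely depends on
the budgets): fixed force `K_{1,1}`, laminar laws `δ_{K_{1,1/(4π²ν)}}` along `ν → 0` with budgets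
`E(ν) = 1/(32π⁴ν²)`, `ε(ν) = 1/(8π²ν)`; the Doering–Foias budget caps every Leray–Hopf solution of energy `≤ M`
at dissipation `√(M/2)`, below `ε(ν)/2` once `ν < 1/(16π²(√(M/2)+1))`.
(The refuted statement — STRENGTHENING 1 — `EnsembleRealization` with `∃ M` moved before `∀ E ε`, all else
verbatim.) [folklore] -/
theorem not_ensembleRealization_uniformM :
    ¬ (∀ f : UnitAddTorus (Fin 3) → EuclideanSpace ℝ (Fin 3), Literature.Analysis.FunctionSpaces.Torus.IsSmooth f → Literature.Analysis.FunctionSpaces.Torus.IsDivFree f → Literature.Analysis.FunctionSpaces.Torus.HasZeroMean f → ∃ M : ℝ, ∀ (E ε : ℝ), 0 < ε → ∀ (ν : ℝ) (μ : MeasureTheory.Measure (Literature.Analysis.FunctionSpaces.Torus.energySpace (Fin 3))), 0 < ν → Literature.Analysis.FluidPDE.Torus.IsStationaryStatisticalSolution ν f μ → MeasureTheory.Integrable (fun u => ‖u‖ ^ 2) μ → Literature.Analysis.FluidPDE.Torus.ensembleEnergy μ ≤ E → ε ≤ Literature.Analysis.FluidPDE.Torus.ensembleDissipation ν μ → ∃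 (u₀ : UnitAddTorus (Fin 3) → EuclideanSpace ℝ (Fin 3)) (u : ℝ → UnitAddTorus (Fin 3) → EuclideanSpace ℝ (Fin 3)), Literature.Analysis.FluidPDE.Torus.IsGlobalLerayHopf ν (fun _ => f) u₀ u ∧ Literature.Analysis.FluidPDE.meanEnergy u ≤ M ∧ ε / 2 ≤ Literature.Analysis.FluidPDE.meanDissipation ν u) := by
  intro h
  obtain ⟨M, hM⟩ := h (shearField 1 1) (isSmooth_shearField 1 1) (isDivFree_shearField 1 1)
    (hasZeroMean_shearField one_ne_zero 1)
  set S : ℝ := Real.sqrt (1 / 2) * Real.sqrt (max M 0) with hS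
  have hS0 : 0 ≤ S := mul_nonneg (Real.sqrt_nonneg _) (Real.sqrt_nonneg _)
  have hS1 : 0 < S + 1 := by linarith
  set ν : ℝ := 1 / (16 * Real.pi ^ 2 * (S + 1)) with hν
  have hπ : 0 < Real.pi := Real.pi_pos
  have hνpos : 0 < ν := by positivity
  have hεpos : 0 < ν * (2 * Real.pi ^ 2 * ((1 : ℕ) : ℝ) ^ 2 * (1 / (4 * Real.pi ^ 2 * ν)) ^ 2) := by positivity
  have hfloor := laminar_energy_floor hνpos (M := M) fun μ hμ hi hE hεμ => hM _ _ hεpos ν μ hνpos hμ hi hE hεμ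
  have hval : 1 / (16 * Real.pi ^ 2 * ν) = S + 1 := by
    rw [hν]
    field_simp
  rw [hval] at hfloor
  linarith

/-! ## §6 The vacuity regime: admissible budgets obey `ε ≤ ‖f‖₂ √E` -/

/-- **Budget of an admissible law**: Foias–Prodi stationarity with `∫|u|² dμ ≤ E` and `ν∫‖∇u‖² dμ ≥ ε` forces
`ε ≤ ‖f‖₂ √E` (in tree: `ensembleDissipation_le_of_isStationary_holds`). [folklore] -/
theorem budget_of_admissible {ν : ℝ} {f : T3 → R3} (hf : Torus.IsSmooth f) {μ : Measure H3}
    (hμ : Torus.IsStationaryStatisticalSolution ν f μ) (hi : Integrable (fun u : H3 => ‖u‖ ^ 2) μ) {E ε : ℝ}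
    (hE : Torus.ensembleEnergy μ ≤ E) (hε : ε ≤ Torus.ensembleDissipation ν μ) :
    ε ≤ Real.sqrt (∫ x, ‖f x‖ ^ 2) * Real.sqrt E :=
  hε.trans ((Torus.ensembleDissipation_le_of_isStationary_holds hμ (hf.memLp 2) hi).trans
    (mul_le_mul_of_nonneg_left (Real.sqrt_le_sqrt hE) (Real.sqrt_nonneg _)))

/-- **VACUITY REGIME.** For budgets beyond the Doering–Foias line, `‖f‖₂ √E < ε`, no Foias–Prodi law meets the
hypotheses, so the crux's implication holds there for EVERY `M` (the content of the crux lives in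
`0 < ε ≤ ‖f‖₂ √E`). [folklore] -/
theorem ensembleRealization_vacuous_regime (f : T3 → R3) (hf : Torus.IsSmooth f) (E ε M : ℝ)
    (hgap : Real.sqrt (∫ x, ‖f x‖ ^ 2) * Real.sqrt E < ε) :
    ∀ (ν : ℝ) (μ : Measure H3), 0 < ν → Torus.IsStationaryStatisticalSolution ν f μ →
      Integrable (fun u : H3 => ‖u‖ ^ 2) μ → Torus.ensembleEnergy μ ≤ E → ε ≤ Torus.ensembleDissipation ν μ →
        ∃ (u₀ : T3 → R3) (u : ℝ → T3 → R3), Torus.IsGlobalLerayHopf ν (fun _ => f) u₀ u ∧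
          meanEnergy u ≤ M ∧ ε / 2 ≤ meanDissipation ν u :=
  fun _ν _μ _ hμ hi hE hε => absurd (budget_of_admissible hf hμ hi hE hε) (not_le.2 hgap)

/-- **NON-VACUITY inside the line.** The hypotheses of the crux ARE met (so the crux is not vacuously true):
for every `ν > 0` the laminar law of `K_{1,1}` is admissible at `E = a²/2`, `ε = 2π²νa²`, `a = 1/(4π²ν)`. [folklore] -/
theorem exists_admissible {ν : ℝ} (hν : 0 < ν) :
    ∃ (μ : Measure H3) (E ε : ℝ), 0 < ε ∧ Torus.IsStationaryStatisticalSolution ν (shearField 1 1) μ ∧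
      Integrable (fun u : H3 => ‖u‖ ^ 2) μ ∧ Torus.ensembleEnergy μ ≤ E ∧ ε ≤ Torus.ensembleDissipation ν μ := by
  have hπ : 0 < Real.pi := Real.pi_pos
  have hν0 : ν ≠ 0 := hν.ne'
  set a : ℝ := 1 / (4 * Real.pi ^ 2 * ν) with ha
  have ha0 : 0 < a := by positivity
  have hfa : shearField 1 (4 * Real.pi ^ 2 * ν * ((1 : ℕ) : ℝ) ^ 2 * a) = shearField 1 1 := by
    congr 1
    simp only [ha, Nat.cast_one, one_pow, mul_one]
    field_simp
  have hFP := isStationaryStatisticalSolution_dirac_shearState one_ne_zero ν a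
  rw [hfa] at hFP
  refine ⟨_, a ^ 2 / 2, ν * (2 * Real.pi ^ 2 * ((1 : ℕ) : ℝ) ^ 2 * a ^ 2), by positivity, hFP,
    Torus.integrable_dirac _ _, le_of_eq (by rw [ensembleEnergy_dirac, norm_sq_shearState]),
    ge_of_eq (by rw [ensembleDissipation_dirac, eGradNormSq_shearState, ENNReal.toReal_ofReal (by positivity)])⟩

end Summit.AnomalousDissipation.AnomalousDissipation.Theorems.EnsembleRealization.Negative
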